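import Literature.Probability.LatticeModels.ProdBernoulliSplice
import Literature.Probability.LatticeModels.IsoradialPercolationProofs
import Literature.Probability.Percolation.Percolation
import HarnessLib

/-!
# Inequalities with a bystander: an event determined by infinitely many coordinates may be replaced by
# its finite-window sections (product measures)

Topic: `Literature/Probability/LatticeModels`.  Theorems only (no definitions, no named facts).

Let `μ = prodBernoulli p` on `Set ι` (`ι` countable), let `E`, `F` be events determined by a FINITE set
of coordinates `W`, and let `K ≥ 0`.  A typical surgery estimate of percolation theory
("`P[G ∩ E] ≤ K · P[G ∩ F]` for every event `G` determined by the coordinates in `Ω`", e.g. the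
corner gluings in Newman–Tassion–Wu's proof of their Theorem 3.10, where `G` is a bystander event
living off the surgery's square) is proved by a counting argument (NTW's Lemma 3.5 / the tree's
`lemma7_bond`) that needs ALL events involved to be determined by finitely many coordinates.  This
file removes that restriction on the bystander: it suffices to prove the inequality for the events
`G'` determined by the finite set `W ∩ Ω`.  Proof: Bollobás–Riordan's splice with the constant
stopping set `W` (`Literature/…/ProdBernoulliSplice`: `(μ ⊗ μ) ∘ splice⁻¹ = μ`), Tonelli in the
second variable, and the observation that every section `{ω₁ | splice (ω₁, ω₂) ∈ G}` is determined by
`W ∩ Ω` when `G` is determined by `Ω`.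

* `determinedBy_section_splice` — the sections of a bystander are finite-window bystanders.
* `prodBernoulli_inter_le_of_sections`, `prodBernoulli_real_inter_le_of_sections` — the reduction
  for `prodBernoulli`.
* `bondPercolation_real_inter_le_of_sections` — the same for bond percolation on any graph.

## Sources

* B. Bollobás, O. Riordan, *Percolation on self-dual polygon configurations*, in: An irregular mind,
  Bolyai Soc. Math. Stud. 21 (2010) 131–217, §5.1 (the splice `f_ALG` is measure preserving)
  [BollobasRiordan2010].
* C. M. Newman, V. Tassion, W. Wu, *Critical percolation and the minimal spanning tree in slabs*,
  Comm. Pure Appl. Math. 70 (2017), §3.4, proof of Theorem 3.10, (3.121)–(3.122) (gluing in the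
  presence of the event `E`) [NewmanTassionWu2017].
-/

noncomputable section

namespace Literature.Probability.LatticeModels

open _root_.MeasureTheory Measure ProbabilityTheory Literature.Probability.Percolation
open scoped ENNReal

variable {ι : Type*}

/-- **Sections of a bystander through the constant-window splice are finite-window bystanders**: if `G`
is determined by the coordinates in `Ω`, then for every `ω₂` the section
`{ω₁ | (ω₁ ∩ W) ∪ (ω₂ ∖ W) ∈ G}` is determined by the coordinates in `W ∩ Ω`.
[cite: BollobasRiordan2010, §5.1 (proof of Thm. 5.3, "ω ∈ G_ε iff ω₁ ∈ G_ε")] -/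
theorem determinedBy_section_splice (W : Finset ι) {Ω : Set ι} {G : Set (Set ι)} (hG : DeterminedBy G Ω)
    (ω₂ : Set ι) :
    DeterminedBy {ω₁ : Set ι | splice (fun _ => W) (fun q : Set ι × Set ι => q.2) (ω₁, ω₂) ∈ G} (↑W ∩ Ω) := by
  rw [determinedBy_iff] at hG ⊢
  intro ω₁ ω₁' heq
  simp only [Set.mem_setOf_eq]
  refine hG _ _ ?_
  ext i
  simp only [Set.mem_inter_iff, mem_splice_iff]
  constructor
  · rintro ⟨h | h, hi⟩
    · have : i ∈ ω₁' ∩ (↑W ∩ Ω) := by rw [← heq]; exact ⟨h.1, Finset.mem_coe.2 h.2, hi⟩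
      exact ⟨Or.inl ⟨this.1, h.2⟩, hi⟩
    · exact ⟨Or.inr h, hi⟩
  · rintro ⟨h | h, hi⟩
    · have : i ∈ ω₁ ∩ (↑W ∩ Ω) := by rw [heq]; exact ⟨h.1, Finset.mem_coe.2 h.2, hi⟩
      exact ⟨Or.inl ⟨this.1, h.2⟩, hi⟩
    · exact ⟨Or.inr h, hi⟩

/-- The section of an event determined by the window `W` itself is the event. [cite: BollobasRiordan2010, §5.1 (proof of Thm. 5.3)] -/
theorem section_splice_eq_of_determinedBy (W : Finset ι) {E : Set (Set ι)} (hE : DeterminedBy E ↑W) (ω₂ : Set ι) :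
    {ω₁ : Set ι | splice (fun _ => W) (fun q : Set ι × Set ι => q.2) (ω₁, ω₂) ∈ E} = E := by
  ext ω₁
  simp only [Set.mem_setOf_eq]
  exact splice_mem_iff_of_determinedBy (𝒮 := fun _ => W) (fun q : Set ι × Set ι => q.2) (ω₁, ω₂) hE

variable [Countable ι] (p : ι → unitInterval)

/-- **The reduction, `ℝ≥0∞` form.**  `μ = prodBernoulli p`; `E`, `F` measurable and determined by the
finite window `W`; `K : ℝ≥0∞`.  If `μ (G' ∩ E) ≤ K · μ (G' ∩ F)` for every measurable `G'` determined by
`W ∩ Ω`, then `μ (G ∩ E) ≤ K · μ (G ∩ F)` for every measurable `G` determined by `Ω`.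
[cite: BollobasRiordan2010, §5.1 (f_ALG is measure preserving)] [cite: NewmanTassionWu2017, §3.4 (proof of Theorem 3.10, (3.121)–(3.122))] -/
theorem prodBernoulli_inter_le_of_sections (W : Finset ι) {Ω : Set ι} {E F : Set (Set ι)}
    (hE : DeterminedBy E ↑W) (hF : DeterminedBy F ↑W) (hEm : MeasurableSet E) (hFm : MeasurableSet F)
    (K : ℝ≥0∞)
    (h : ∀ G' : Set (Set ι), DeterminedBy G' (↑W ∩ Ω) → MeasurableSet G' →
      prodBernoulli p (G' ∩ E) ≤ K * prodBernoulli p (G' ∩ F))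
    {G : Set (Set ι)} (hG : DeterminedBy G Ω) (hGm : MeasurableSet G) :
    prodBernoulli p (G ∩ E) ≤ K * prodBernoulli p (G ∩ F) := by
  classical
  set μ := prodBernoulli p with hμ
  set 𝒮 : Set ι → Finset ι := fun _ => W with h𝒮
  set η : Set ι × Set ι → Set ι := fun q => q.2 with hη
  have h𝒮st : IsStoppingSet 𝒮 := IsStoppingSet.const W
  have hηm : Measurable η := measurable_snd
  have hlaw : ∀ ω₁ : Set ι, μ.map (fun w => η (ω₁, w)) = prodBernoulli p := fun ω₁ => by
    simp only [hη]; exact Measure.map_id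
  have hsm : Measurable (splice 𝒮 η) := measurable_splice h𝒮st hηm
  -- through the splice
  rw [prodBernoulli_apply_eq_prod_preimage_splice p h𝒮st hηm hlaw (hGm.inter hEm),
    prodBernoulli_apply_eq_prod_preimage_splice p h𝒮st hηm hlaw (hGm.inter hFm),
    Measure.prod_apply_symm (hsm (hGm.inter hEm)), Measure.prod_apply_symm (hsm (hGm.inter hFm))]
  -- the sections
  have hsecE : ∀ ω₂ : Set ι, (fun ω₁ => (ω₁, ω₂)) ⁻¹' (splice 𝒮 η ⁻¹' (G ∩ E)) =
      {ω₁ : Set ι | splice 𝒮 η (ω₁, ω₂) ∈ G} ∩ E := by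
    intro ω₂
    ext ω₁
    simp only [Set.mem_preimage, Set.mem_inter_iff, Set.mem_setOf_eq]
    rw [splice_mem_iff_of_determinedBy (𝒮 := 𝒮) η (ω₁, ω₂) hE]
  have hsecF : ∀ ω₂ : Set ι, (fun ω₁ => (ω₁, ω₂)) ⁻¹' (splice 𝒮 η ⁻¹' (G ∩ F)) =
      {ω₁ : Set ι | splice 𝒮 η (ω₁, ω₂) ∈ G} ∩ F := by
    intro ω₂
    ext ω₁
    simp only [Set.mem_preimage, Set.mem_inter_iff, Set.mem_setOf_eq]
    rw [splice_mem_iff_of_determinedBy (𝒮 := 𝒮) η (ω₁, ω₂) hF]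
  have hGsec : ∀ ω₂ : Set ι, MeasurableSet {ω₁ : Set ι | splice 𝒮 η (ω₁, ω₂) ∈ G} := fun ω₂ =>
    (hsm.comp (measurable_id.prodMk measurable_const)) hGm
  have hpt : ∀ ω₂ : Set ι, μ ((fun ω₁ => (ω₁, ω₂)) ⁻¹' (splice 𝒮 η ⁻¹' (G ∩ E))) ≤
      K * μ ((fun ω₁ => (ω₁, ω₂)) ⁻¹' (splice 𝒮 η ⁻¹' (G ∩ F))) := by
    intro ω₂
    rw [hsecE, hsecF]
    exact h _ (determinedBy_section_splice W hG ω₂) (hGsec ω₂)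
  calc ∫⁻ ω₂, μ ((fun ω₁ => (ω₁, ω₂)) ⁻¹' (splice 𝒮 η ⁻¹' (G ∩ E))) ∂μ
      ≤ ∫⁻ ω₂, K * μ ((fun ω₁ => (ω₁, ω₂)) ⁻¹' (splice 𝒮 η ⁻¹' (G ∩ F))) ∂μ := lintegral_mono hpt
    _ = K * ∫⁻ ω₂, μ ((fun ω₁ => (ω₁, ω₂)) ⁻¹' (splice 𝒮 η ⁻¹' (G ∩ F))) ∂μ := by
        rw [lintegral_const_mul]
        exact measurable_measure_prodMk_right (hsm (hGm.inter hFm))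

/-- **The reduction, real form**: with `K ≥ 0`, if `μ.real (G' ∩ E) ≤ K · μ.real (G' ∩ F)` for every
measurable `G'` determined by the finite set `W ∩ Ω`, then the same holds for every measurable `G`
determined by `Ω`. [cite: BollobasRiordan2010, §5.1 (f_ALG is measure preserving)] [cite: NewmanTassionWu2017, §3.4 (proof of Theorem 3.10, (3.121)–(3.122))] -/
theorem prodBernoulli_real_inter_le_of_sections (W : Finset ι) {Ω : Set ι} {E F : Set (Set ι)}
    (hE : DeterminedBy E ↑W) (hF : DeterminedBy F ↑W) (hEm : MeasurableSet E) (hFm : MeasurableSet F)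
    {K : ℝ} (hK : 0 ≤ K)
    (h : ∀ G' : Set (Set ι), DeterminedBy G' (↑W ∩ Ω) → MeasurableSet G' →
      (prodBernoulli p).real (G' ∩ E) ≤ K * (prodBernoulli p).real (G' ∩ F))
    {G : Set (Set ι)} (hG : DeterminedBy G Ω) (hGm : MeasurableSet G) :
    (prodBernoulli p).real (G ∩ E) ≤ K * (prodBernoulli p).real (G ∩ F) := by
  set μ := prodBernoulli p with hμ
  have h' : ∀ G' : Set (Set ι), DeterminedBy G' (↑W ∩ Ω) → MeasurableSet G' →
      μ (G' ∩ E) ≤ ENNReal.ofReal K * μ (G' ∩ F) := by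
    intro G' hG' hG'm
    have h1 := h G' hG' hG'm
    rw [measureReal_def, measureReal_def, ← ENNReal.toReal_ofReal hK, ← ENNReal.toReal_mul] at h1
    exact (ENNReal.toReal_le_toReal (measure_ne_top _ _)
      (ENNReal.mul_ne_top ENNReal.ofReal_ne_top (measure_ne_top _ _))).1 h1
  have hmain := prodBernoulli_inter_le_of_sections p W hE hF hEm hFm (ENNReal.ofReal K) h' hG hGm
  rw [measureReal_def, measureReal_def, ← ENNReal.toReal_ofReal hK, ← ENNReal.toReal_mul]
  exact ENNReal.toReal_mono (ENNReal.mul_ne_top ENNReal.ofReal_ne_top (measure_ne_top _ _)) hmain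

/-- **Bond-percolation form**: for `P_p^G` on any graph with countably many vertex pairs, an inequality
`P[G' ∩ E] ≤ K · P[G' ∩ F]` for all measurable `G'` determined by the finite set of pairs `W ∩ Ω`
(`E`, `F` measurable, determined by `W`) extends to all measurable `G` determined by `Ω`.
[cite: NewmanTassionWu2017, §3.4 (proof of Theorem 3.10, (3.121)–(3.122): gluing in the presence of E)] -/
theorem bondPercolation_real_inter_le_of_sections {V : Type*} [Countable (Sym2 V)] (Gr : SimpleGraph V)
    (q : unitInterval) (W : Finset (Sym2 V)) {Ω : Set (Sym2 V)} {E F : Set (BondConfig V)}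
    (hE : DeterminedBy E ↑W) (hF : DeterminedBy F ↑W) (hEm : MeasurableSet E) (hFm : MeasurableSet F)
    {K : ℝ} (hK : 0 ≤ K)
    (h : ∀ G' : Set (BondConfig V), DeterminedBy G' (↑W ∩ Ω) → MeasurableSet G' →
      (bondPercolation Gr q).real (G' ∩ E) ≤ K * (bondPercolation Gr q).real (G' ∩ F))
    {G : Set (BondConfig V)} (hG : DeterminedBy G Ω) (hGm : MeasurableSet G) :
    (bondPercolation Gr q).real (G ∩ E) ≤ K * (bondPercolation Gr q).real (G ∩ F) := by
  classical
  have hP : bondPercolation Gr q = prodBernoulli fun e => if e ∈ Gr.edgeSet then q else 0 := by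
    rw [prodBernoulli_indicator_holds]; rfl
  rw [hP] at h ⊢
  exact prodBernoulli_real_inter_le_of_sections _ W hE hF hEm hFm hK h hG hGm

end Literature.Probability.LatticeModels

end
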